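import Literature.MathematicalPhysics.KineticTheory.InfiniteChainWindowKernel
import Literature.Analysis.OperatorTheory.KernelSectionPositivity
import Literature.Analysis.OperatorTheory.PowerIterationRatioLimit
import Literature.Analysis.OperatorTheory.PositivityImprovingSpectralGap
import HarnessLib

/-!
# Bulk Gibbs expectations of the chain forget far-away boundary conditions

Topic `Literature/MathematicalPhysics/KineticTheory`; theorems only (no definitions, no named
facts). This file assembles the transfer-operator proof that the finite-volume Gibbs distributions
`γ_Λ(· | η)` of a one-dimensional nearest-neighbour chain `P : OscillatorChain` at `T > 0`
(`U`, `V` continuous, `V ≥ 0` even, `e^{-U/T} ∈ L¹`) become independent of the boundary condition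
as the volume grows, UNIFORMLY on the boundary conditions whose two boundary spins lie in the
exhausting sets `{u : Φ(u) ≥ δ}` (`Φ(u) = ⟪φ, k_u⟫ > 0`, `φ` the Perron–Frobenius–Jentzsch
eigenvector of the transfer operator on `L²` of the a priori measure `ρ_T = e^{-(p²/2+U)/T} dq dp`,
`k_u` its kernel sections): for a window observable `0 ≤ F ≤ 1` there is a number `L_F` with
`|γ_{\{c-n,…,d+n\}}(F | η) - L_F| < ε` for `n ≥ N₀(δ, ε)` whenever `Φ(η_{c-n-1}), Φ(η_{d+n+1}) ≥ δ`
(Cassandro–Olivieri–Pellegrinotti–Presutti 1978, §3, for this class of unbounded-spin chains;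
Georgii 2011, Ch. 10–11; the analytic core is
`Literature.Analysis.OperatorTheory.exists_forall_abs_ratio_sub_lt`, fed by the Jentzsch gap
`IsPositivityImproving.exists_norm_pow_sub_le`).

* `lmarginal_boltzmann_eq_ofReal_inner` — the un-normalised interval Gibbs integral of a window
  observable is `ofReal ⟪Aⁿ k_u, M_G Aⁿ k_v⟫` (`A` the `L²(ρ_T)` transfer operator, `M_G` the `L²`
  window operator), combining `lmarginal_Icc_boltzmann_eq_iterate` with the `ℝ≥0∞`/real bridges;
* `exists_boundary_uniform_ratio_limit` (**main**) — the statement above.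

[cite: Georgii2011, Thm 10.25 and §11.1]
-/

noncomputable section

open MeasureTheory Set Function Filter Finset Literature.Probability.LatticeModels
  Literature.Analysis.OperatorTheory
open scoped RealInnerProductSpace ENNReal

namespace Literature.MathematicalPhysics.KineticTheory.HeatConduction

namespace OscillatorChain

variable (P : OscillatorChain)

/-- **The interval Gibbs integral of a window observable as an `L²` matrix element.** In the setting
of `lmarginal_Icc_boltzmann_eq_iterate` (`k = ofReal ∘ K`, `w`, window `{c,…,d}`, `c < d`,
observable `G` reading the window), let `ρ = w · Leb` (finite), `A` an `L²(ρ)` operator with kernel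
`K` (symmetric, bounded by `1`, non-negative), `M_G` an `L²(ρ)` operator with the real window kernel
`m_G` (`ofReal ∘ m_G` = the `ℝ≥0∞` window kernel, `m_G ≥ 0` bounded). Then for every `n` and `η`,
with `u = η_{c-n-1}`, `v = η_{d+n+1}` and kernel sections `k_u = K(u,·)`:
`(∫⋯∫⁻_{\{c-n,…,d+n\}} G e^{-H/T})(η) = ofReal ⟪Aⁿ k_u, M_G (Aⁿ k_v)⟫` and the matrix element is
non-negative. [cite: Georgii2011, Thm 10.25 and §11.1] -/
theorem lmarginal_boltzmann_eq_ofReal_inner {T : ℝ} {K : ℝ × ℝ → ℝ × ℝ → ℝ}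
    {k : ℝ × ℝ → ℝ × ℝ → ℝ≥0∞} {w : ℝ × ℝ → ℝ≥0∞}
    (hw : ∀ z, w z = ENNReal.ofReal (Real.exp (-T⁻¹ * (z.2 ^ 2 / 2 + P.U z.1))))
    (hk : ∀ z z', k z z' = ENNReal.ofReal (Real.exp (-T⁻¹ * P.V (z'.1 - z.1))))
    (hK : ∀ z z', K z z' = Real.exp (-T⁻¹ * P.V (z'.1 - z.1)))
    (hkm : Measurable (uncurry k)) (hwm : Measurable w) (hKsm : StronglyMeasurable (uncurry K))
    (hK1 : ∀ x y, ‖K x y‖ ≤ 1) (hKsymm : ∀ x y, K x y = K y x)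
    {ρ : Measure (ℝ × ℝ)} (hρ : ρ = (volume : Measure (ℝ × ℝ)).withDensity w) [IsFiniteMeasure ρ]
    {A : Lp ℝ 2 ρ →L[ℝ] Lp ℝ 2 ρ} (hAsa : IsSelfAdjoint A)
    (hA : ∀ ψ : Lp ℝ 2 ρ, (A ψ : ℝ × ℝ → ℝ) =ᵐ[ρ] fun x => ∫ y, K x y * ψ y ∂ρ)
    {c d : ℤ} (hcd : c < d) {G : ChainConfig → ℝ≥0∞} (hGm : Measurable G)
    (hGd : DependsOn G (↑(Finset.Icc c d) : Set ℤ)) (η₀ : ChainConfig)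
    {MK : ℝ × ℝ → ℝ × ℝ → ℝ≥0∞}
    (hMK : ∀ x y, MK x y = (∫⋯∫⁻_Finset.Icc (c + 1) (d - 1), (fun σ => G σ *
        (∏ y' ∈ Finset.Icc (c + 1) (d - 1), (w (σ y') * k (σ (y' - 1)) (σ y'))) * k (σ (d - 1)) (σ d))
          ∂fun _ : ℤ => (volume : Measure (ℝ × ℝ)))
            (Function.update (Function.update η₀ c x) d y))
    {MR : ℝ × ℝ → ℝ × ℝ → ℝ} (hMR : ∀ x y, MK x y = ENNReal.ofReal (MR x y))
    (hMR0 : ∀ x y, 0 ≤ MR x y) {CM : ℝ} (hMRb : ∀ x y, ‖MR x y‖ ≤ CM)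
    (hMRsm : StronglyMeasurable (uncurry MR))
    {M : Lp ℝ 2 ρ →L[ℝ] Lp ℝ 2 ρ}
    (hM : ∀ ψ : Lp ℝ 2 ρ, (M ψ : ℝ × ℝ → ℝ) =ᵐ[ρ] fun x => ∫ y, MR x y * ψ y ∂ρ)
    (n : ℕ) (η : ChainConfig) :
    (∫⋯∫⁻_Finset.Icc (c - n) (d + n), (fun σ => G σ *
        ENNReal.ofReal (Real.exp (-T⁻¹ *
          hamiltonianIn P.chainPotential chainSupp (Finset.Icc (c - n) (d + n)) σ)))
      ∂fun _ : ℤ => (volume : Measure (ℝ × ℝ))) η =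
      ENNReal.ofReal ⟪(A ^ n) ((memLp_kernel_section (μ := ρ) hKsm hK1 (η (c - n - 1))).toLp
          (K (η (c - n - 1)))),
        M ((A ^ n) ((memLp_kernel_section (μ := ρ) hKsm hK1 (η (d + n + 1))).toLp
          (K (η (d + n + 1)))))⟫ ∧
    0 ≤ ⟪(A ^ n) ((memLp_kernel_section (μ := ρ) hKsm hK1 (η (c - n - 1))).toLp
          (K (η (c - n - 1)))),
        M ((A ^ n) ((memLp_kernel_section (μ := ρ) hKsm hK1 (η (d + n + 1))).toLp
          (K (η (d + n + 1)))))⟫ := by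
  subst hρ
  set u : ℝ × ℝ := η (c - n - 1) with hu
  set v : ℝ × ℝ := η (d + n + 1) with hv
  -- the transfer map, the window operator, the real kernel operator
  set Tr : (ℝ × ℝ → ℝ≥0∞) → (ℝ × ℝ → ℝ≥0∞) := fun f z => ∫⁻ y, k z y * w y * f y with hTrdef
  have hTr : ∀ f z, Tr f z = ∫⁻ y, k z y * w y * f y := fun _ _ => rfl
  set TM : (ℝ × ℝ → ℝ≥0∞) → (ℝ × ℝ → ℝ≥0∞) := fun ψ x => (∫⋯∫⁻_Finset.Icc (c + 1) d, (fun σ => G σ *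
      (∏ y ∈ Finset.Icc (c + 1) d, (w (σ y) * k (σ (y - 1)) (σ y))) * ψ (σ d))
        ∂fun _ : ℤ => (volume : Measure (ℝ × ℝ))) (Function.update η₀ c x) with hTMdef
  have hTM : ∀ ψ x, TM ψ x = (∫⋯∫⁻_Finset.Icc (c + 1) d, (fun σ => G σ *
      (∏ y ∈ Finset.Icc (c + 1) d, (w (σ y) * k (σ (y - 1)) (σ y))) * ψ (σ d))
        ∂fun _ : ℤ => (volume : Measure (ℝ × ℝ))) (Function.update η₀ c x) := fun _ _ => rfl
  set κ : (ℝ × ℝ → ℝ) → (ℝ × ℝ → ℝ) := fun g x => ∫ y, K x y * g y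
    ∂((volume : Measure (ℝ × ℝ)).withDensity w) with hκdef
  have hK0 : ∀ x y, 0 ≤ K x y := fun x y => by rw [hK]; exact (Real.exp_pos _).le
  have hkK : ∀ x y, k x y = ENNReal.ofReal (K x y) := fun x y => by rw [hk, hK]
  -- Step 1: the interval integral as iterates of the transfer map
  have h1 := P.lmarginal_Icc_boltzmann_eq_iterate hw hk hkm hwm hTr hcd hGm hGd η₀ hTM n η
  rw [h1]
  -- Step 2: `T^[n] k_v = ofReal ∘ κ^[n] K_v`
  have hKvm : Measurable (K v) := hKsm.measurable.of_uncurry_left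
  have hKvb : ∀ x, ‖K v x‖ ≤ 1 := fun x => hK1 v x
  have hkv : (fun z => k z v) = fun z => ENNReal.ofReal (K v z) := by
    funext z; rw [hkK, hKsymm]
  obtain ⟨h2, h2pos⟩ := iterate_transfer_ofReal_eq hwm hkK hK0 hK1 hKsm hTr hKvm ⟨1, hKvb⟩
    (fun x => hK0 v x) n
  obtain ⟨⟨B₁, hB₁⟩, hg₁sm⟩ := exists_bound_and_measurable_kernelIterate
    (μ := (volume : Measure (ℝ × ℝ)).withDensity w) hKsm hK1 hKvm ⟨1, hKvb⟩ n
  set g₁ : ℝ × ℝ → ℝ := κ^[n] (K v) with hg₁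
  -- Step 3: `TM (ofReal ∘ g₁) = ofReal ∘ h`, `h x = ∫ MR(x,y) g₁(y) dρ`
  set h : ℝ × ℝ → ℝ := fun x => ∫ y, MR x y * g₁ y ∂((volume : Measure (ℝ × ℝ)).withDensity w)
    with hh
  have h3 : TM (fun y => ENNReal.ofReal (g₁ y)) = fun x => ENNReal.ofReal (h x) := by
    funext x
    rw [windowOp_eq_lintegral_windowKernel hkm hwm hcd hGm hTM hMK
      hg₁sm.measurable.ennreal_ofReal x]
    exact lintegral_kernel_weight_ofReal_eq hwm hMR hMR0 hMRb hMRsm hg₁sm.measurable hB₁ h2pos x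
  have hhm : Measurable h :=
    (hMRsm.mul (hg₁sm.comp_measurable measurable_snd)).integral_prod_right'.measurable
  have hh0 : ∀ x, 0 ≤ h x := fun x => integral_nonneg fun y => mul_nonneg (hMR0 x y) (h2pos y)
  have hhb : ∀ x, ‖h x‖ ≤ CM * (B₁ * ((volume : Measure (ℝ × ℝ)).withDensity w).real univ) := by
    intro x
    calc ‖∫ y, MR x y * g₁ y ∂((volume : Measure (ℝ × ℝ)).withDensity w)‖
        ≤ ∫ y, ‖MR x y * g₁ y‖ ∂((volume : Measure (ℝ × ℝ)).withDensity w) :=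
          norm_integral_le_integral_norm _
      _ ≤ ∫ _y, CM * B₁ ∂((volume : Measure (ℝ × ℝ)).withDensity w) := by
          refine integral_mono_of_nonneg (Eventually.of_forall fun y => norm_nonneg _)
            (integrable_const _) (Eventually.of_forall fun y => ?_)
          dsimp only
          rw [norm_mul]
          exact mul_le_mul (hMRb x y) (hB₁ y) (norm_nonneg _) ((norm_nonneg _).trans (hMRb x y))
      _ = CM * (B₁ * ((volume : Measure (ℝ × ℝ)).withDensity w).real univ) := by
          rw [integral_const, smul_eq_mul]; ring
  -- Step 4: `T^[n+1] (ofReal ∘ h) = ofReal ∘ κ^[n+1] h`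
  obtain ⟨h4, h4pos⟩ := iterate_transfer_ofReal_eq hwm hkK hK0 hK1 hKsm hTr hhm ⟨_, hhb⟩ hh0 (n + 1)
  have hNum : (Tr^[n + 1] (TM (Tr^[n] fun z => k z (η (d + n + 1))))) (η (c - n - 1)) =
      ENNReal.ofReal ((κ^[n + 1] h) u) := by
    rw [← hv, ← hu, hkv, h2, h3, h4]
  rw [hNum]
  -- Step 5: `κ^[n+1] h (u) = ⟪k_u, Aⁿ [h]⟫ = ⟪Aⁿ k_u, M (Aⁿ k_v)⟫`
  have h5 := inner_kernel_section_pow_kernelOp (μ := (volume : Measure (ℝ × ℝ)).withDensity w)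
    hKsm hK1 hKsymm hA hhm hhb n u
  have hMv : M ((A ^ n) ((memLp_kernel_section (μ := (volume : Measure (ℝ × ℝ)).withDensity w)
      hKsm hK1 v).toLp (K v))) =
      (memLp_two_of_bound (μ := (volume : Measure (ℝ × ℝ)).withDensity w) hhm hhb).toLp h := by
    apply Lp.ext
    have hpow := pow_kernelOp_toLp_ae_eq_iterate (μ := (volume : Measure (ℝ × ℝ)).withDensity w)
      hA hKvm hKvb n
    filter_upwards [hM ((A ^ n) ((memLp_kernel_section
      (μ := (volume : Measure (ℝ × ℝ)).withDensity w) hKsm hK1 v).toLp (K v))),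
      (memLp_two_of_bound (μ := (volume : Measure (ℝ × ℝ)).withDensity w) hhm hhb).coeFn_toLp]
      with x hx hx'
    rw [hx, hx', hh]
    exact integral_congr_ae (by filter_upwards [hpow] with y hy; rw [hy])
  have hsymm : ∀ x y : Lp ℝ 2 ((volume : Measure (ℝ × ℝ)).withDensity w),
      ⟪(A ^ n) x, y⟫ = ⟪x, (A ^ n) y⟫ := fun x y => by
    simpa only [ContinuousLinearMap.coe_coe] using (hAsa.pow n).isSymmetric x y
  have hinner : (κ^[n + 1] h) u =
      ⟪(A ^ n) ((memLp_kernel_section (μ := (volume : Measure (ℝ × ℝ)).withDensity w)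
          hKsm hK1 u).toLp (K u)),
        M ((A ^ n) ((memLp_kernel_section (μ := (volume : Measure (ℝ × ℝ)).withDensity w)
          hKsm hK1 v).toLp (K v)))⟫ := by
    rw [hsymm, hMv, ← h5]
  refine ⟨by rw [hinner], ?_⟩
  rw [← hinner]
  exact h4pos u

/-- **Bulk Gibbs expectations forget far-away boundary conditions, uniformly on exhausting sets of
boundary spins.** For `T > 0`, `U`, `V` continuous, `V ≥ 0` even and `e^{-U/T} ∈ L¹` there is a
measurable, everywhere positive function `Φ` of one spin such that for every window observable
`0 ≤ F ≤ 1` reading `{c, …, d}` (`c < d`) there is a number `L` with: for all `δ, ε > 0` there is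
`N₀` with `|γ_{\{c-n,…,d+n\}}(F | η) - L| < ε` whenever `n ≥ N₀` and the two boundary spins
`η_{c-n-1}`, `η_{d+n+1}` satisfy `Φ ≥ δ`. (`Φ(u) = ⟪φ, k_u⟫` for the Jentzsch eigenvector `φ` of
the transfer operator; `L = ⟪φ, M_F φ⟫ / ⟪φ, M_1 φ⟫`.) The analytic core of uniqueness of the
shift-invariant DLR state of one-dimensional chains (Cassandro–Olivieri–Pellegrinotti–Presutti
1978, §3; Georgii 2011, Ch. 10–11). [cite: Georgii2011, Thm 10.25 and §11.1] -/
theorem exists_boundary_uniform_ratio_limit {T : ℝ} (hT : 0 < T)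
    (hUc : Continuous P.U) (hVc : Continuous P.V) (hV0 : ∀ r, 0 ≤ P.V r)
    (hVe : ∀ r, P.V (-r) = P.V r)
    (hUi : Integrable (fun q : ℝ => Real.exp (-T⁻¹ * P.U q))) :
    ∃ Φ : ℝ × ℝ → ℝ, Measurable Φ ∧ (∀ u, 0 < Φ u) ∧
      ∀ (c d : ℤ), c < d → ∀ (F : ChainConfig → ℝ≥0∞), Measurable F →
        DependsOn F (↑(Finset.Icc c d) : Set ℤ) → (∀ σ, F σ ≤ 1) →
        ∃ L : ℝ, ∀ δ : ℝ, 0 < δ → ∀ ε : ℝ, 0 < ε → ∃ N₀ : ℕ, ∀ n : ℕ, N₀ ≤ n →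
          ∀ η : ChainConfig, δ ≤ Φ (η (c - n - 1)) → δ ≤ Φ (η (d + n + 1)) →
            |(∫⁻ σ, F σ ∂(P.chainSpecification T (Finset.Icc (c - n) (d + n)) η)).toReal - L| < ε := by
  classical
  have hUm : Measurable P.U := hUc.measurable
  have hVm : Measurable P.V := hVc.measurable
  -- the a priori weight, the kernel, the a priori measure
  obtain ⟨wR, hwR⟩ : ∃ wR : ℝ × ℝ → ℝ, ∀ z, wR z = Real.exp (-T⁻¹ * (z.2 ^ 2 / 2 + P.U z.1)) :=
    ⟨_, fun _ => rfl⟩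
  obtain ⟨w, hw⟩ : ∃ w : ℝ × ℝ → ℝ≥0∞, ∀ z, w z = ENNReal.ofReal (wR z) := ⟨_, fun _ => rfl⟩
  have hw' : ∀ z, w z = ENNReal.ofReal (Real.exp (-T⁻¹ * (z.2 ^ 2 / 2 + P.U z.1))) := fun z => by
    rw [hw, hwR]
  obtain ⟨K, hK⟩ : ∃ K : ℝ × ℝ → ℝ × ℝ → ℝ, ∀ z z', K z z' = Real.exp (-T⁻¹ * P.V (z'.1 - z.1)) :=
    ⟨_, fun _ _ => rfl⟩
  obtain ⟨k, hk⟩ : ∃ k : ℝ × ℝ → ℝ × ℝ → ℝ≥0∞, ∀ z z', k z z' = ENNReal.ofReal (K z z') :=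
    ⟨_, fun _ _ => rfl⟩
  have hk' : ∀ z z', k z z' = ENNReal.ofReal (Real.exp (-T⁻¹ * P.V (z'.1 - z.1))) := fun z z' => by
    rw [hk, hK]
  have hwR_eq : wR = fun z => Real.exp (-T⁻¹ * (z.2 ^ 2 / 2 + P.U z.1)) := funext hwR
  have hwRc : Continuous wR := by rw [hwR_eq]; fun_prop
  have hwRi : Integrable wR := by rw [hwR_eq]; exact P.integrable_siteWeight hT hUi
  have hw_eq : w = fun z => ENNReal.ofReal (wR z) := funext hw
  have hwm : Measurable w := by rw [hw_eq]; exact hwRc.measurable.ennreal_ofReal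
  set ρ : Measure (ℝ × ℝ) := (volume : Measure (ℝ × ℝ)).withDensity w with hρ
  haveI : IsFiniteMeasure ρ := by
    rw [hρ, hw_eq]; exact isFiniteMeasure_withDensity_ofReal hwRi.2
  have hρ0 : ρ ≠ 0 := by
    intro h0
    have h1 : ρ univ = 0 := by rw [h0]; rfl
    rw [hρ, withDensity_apply _ MeasurableSet.univ, Measure.restrict_univ,
      lintegral_eq_zero_iff hwm] at h1
    have h2 : (volume : Measure (ℝ × ℝ)) {z | w z ≠ (0 : ℝ × ℝ → ℝ≥0∞) z} = 0 := h1
    have h3 : {z : ℝ × ℝ | w z ≠ (0 : ℝ × ℝ → ℝ≥0∞) z} = univ :=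
      eq_univ_of_forall fun z => by
        simp only [Set.mem_setOf_eq, Pi.zero_apply, hw, hwR]
        exact (ENNReal.ofReal_pos.2 (Real.exp_pos _)).ne'
    rw [h3] at h2
    exact (isOpen_univ.measure_pos (volume : Measure (ℝ × ℝ)) univ_nonempty).ne' h2
  have hK_eq : uncurry K = fun p : (ℝ × ℝ) × (ℝ × ℝ) => Real.exp (-T⁻¹ * P.V (p.2.1 - p.1.1)) :=
    funext fun p => hK p.1 p.2
  have hKc : Continuous (uncurry K) := by rw [hK_eq]; fun_prop
  have hKsm : StronglyMeasurable (uncurry K) := hKc.stronglyMeasurable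
  have hKpos : ∀ z z', 0 < K z z' := fun z z' => by rw [hK]; exact Real.exp_pos _
  have hK1 : ∀ z z', ‖K z z'‖ ≤ 1 := fun z z' => by
    rw [Real.norm_eq_abs, abs_of_pos (hKpos z z'), hK, Real.exp_le_one_iff]
    have := hV0 (z'.1 - z.1)
    have := inv_pos.2 hT
    nlinarith
  have hKsymm : ∀ z z', K z z' = K z' z := fun z z' => by
    rw [hK, hK, ← hVe (z.1 - z'.1), neg_sub]
  have hk_eq : uncurry k = fun p => ENNReal.ofReal (uncurry K p) := funext fun p => hk p.1 p.2
  have hkm : Measurable (uncurry k) := by rw [hk_eq]; exact hKc.measurable.ennreal_ofReal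
  have hk1 : ∀ z z', k z z' ≤ 1 := fun z z' => by
    rw [hk]; exact ENNReal.ofReal_le_one.2 ((le_abs_self _).trans ((Real.norm_eq_abs _) ▸ hK1 z z'))
  have hk0 : ∀ z z', 0 < k z z' := fun z z' => by rw [hk]; exact ENNReal.ofReal_pos.2 (hKpos z z')
  have hw0 : ∀ z, 0 < w z := fun z => by rw [hw, hwR]; exact ENNReal.ofReal_pos.2 (Real.exp_pos _)
  -- the transfer operator and its spectral gap
  obtain ⟨A, hA, hAsa, hAc, hAimp, hA0⟩ := exists_transferOperator (μ := ρ) hKsm hK1 hKsymm hKpos hρ0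
  obtain ⟨φ, hφ1, hφpos, hAφ, θ, hθ0, hθ, hpow⟩ := hAimp.exists_norm_pow_sub_le hAsa hAc hA0
  have hlam : 0 < ‖A‖ := norm_pos_iff.2 hA0
  have hφae : ∀ᵐ x ∂ρ, 0 < φ x := hφpos
  -- kernel sections and the pairing `Φ`
  have hks : ∀ u, ‖(memLp_kernel_section (μ := ρ) hKsm hK1 u).toLp (K u)‖ ≤
      (measureUnivNNReal ρ : ℝ) ^ (2 : ℝ≥0∞).toReal⁻¹ * 1 := fun u =>
    norm_kernel_section_le hKsm hK1 zero_le_one u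
  refine ⟨fun u => ⟪φ, (memLp_kernel_section (μ := ρ) hKsm hK1 u).toLp (K u)⟫,
    measurable_inner_kernel_section hKsm hK1 φ,
    inner_kernel_section_pos hKsm hK1 hKpos hρ0 hφae, ?_⟩
  intro c d hcd F hFm hFd hF1
  -- window kernels of `F` and of `1`
  set η₀ : ChainConfig := fun _ => (0, 0) with hη₀
  obtain ⟨MK, hMK⟩ : ∃ MK : ℝ × ℝ → ℝ × ℝ → ℝ≥0∞, ∀ x y, MK x y =
      (∫⋯∫⁻_Finset.Icc (c + 1) (d - 1), (fun σ => F σ *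
        (∏ y' ∈ Finset.Icc (c + 1) (d - 1), (w (σ y') * k (σ (y' - 1)) (σ y'))) * k (σ (d - 1)) (σ d))
          ∂fun _ : ℤ => (volume : Measure (ℝ × ℝ)))
            (Function.update (Function.update η₀ c x) d y) := ⟨_, fun _ _ => rfl⟩
  obtain ⟨MK₁, hMK₁⟩ : ∃ MK₁ : ℝ × ℝ → ℝ × ℝ → ℝ≥0∞, ∀ x y, MK₁ x y =
      (∫⋯∫⁻_Finset.Icc (c + 1) (d - 1), (fun σ => (fun _ : ChainConfig => (1 : ℝ≥0∞)) σ *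
        (∏ y' ∈ Finset.Icc (c + 1) (d - 1), (w (σ y') * k (σ (y' - 1)) (σ y'))) * k (σ (d - 1)) (σ d))
          ∂fun _ : ℤ => (volume : Measure (ℝ × ℝ)))
            (Function.update (Function.update η₀ c x) d y) := ⟨_, fun _ _ => rfl⟩
  have hCw : (∫⁻ z, w z) ^ (Finset.Icc (c + 1) (d - 1)).card ≠ ∞ := by
    refine ENNReal.pow_ne_top (lt_top_iff_ne_top.1 ?_)
    rw [hw_eq]
    exact (hasFiniteIntegral_iff_ofReal (Eventually.of_forall fun z => by
      rw [hwR]; exact (Real.exp_pos _).le)).1 hwRi.2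
  have hMKle : ∀ x y, MK x y ≤ (∫⁻ z, w z) ^ (Finset.Icc (c + 1) (d - 1)).card :=
    windowKernel_le_pow hwm hF1 hk1 hMK
  have hMK₁le : ∀ x y, MK₁ x y ≤ (∫⁻ z, w z) ^ (Finset.Icc (c + 1) (d - 1)).card :=
    windowKernel_le_pow hwm (fun _ => le_rfl) hk1 hMK₁
  have hMKne : ∀ x y, MK x y ≠ ∞ := fun x y => ne_top_of_le_ne_top hCw (hMKle x y)
  have hMK₁ne : ∀ x y, MK₁ x y ≠ ∞ := fun x y => ne_top_of_le_ne_top hCw (hMK₁le x y)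
  -- real window kernels
  obtain ⟨MR, hMR⟩ : ∃ MR : ℝ × ℝ → ℝ × ℝ → ℝ, ∀ x y, MR x y = (MK x y).toReal := ⟨_, fun _ _ => rfl⟩
  obtain ⟨MR₁, hMR₁⟩ : ∃ MR₁ : ℝ × ℝ → ℝ × ℝ → ℝ, ∀ x y, MR₁ x y = (MK₁ x y).toReal :=
    ⟨_, fun _ _ => rfl⟩
  have hMKR : ∀ x y, MK x y = ENNReal.ofReal (MR x y) := fun x y => by
    rw [hMR, ENNReal.ofReal_toReal (hMKne x y)]
  have hMK₁R : ∀ x y, MK₁ x y = ENNReal.ofReal (MR₁ x y) := fun x y => by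
    rw [hMR₁, ENNReal.ofReal_toReal (hMK₁ne x y)]
  have hMR0 : ∀ x y, 0 ≤ MR x y := fun x y => by rw [hMR]; exact ENNReal.toReal_nonneg
  have hMR₁0 : ∀ x y, 0 ≤ MR₁ x y := fun x y => by rw [hMR₁]; exact ENNReal.toReal_nonneg
  have hMRb : ∀ x y, ‖MR x y‖ ≤ ((∫⁻ z, w z) ^ (Finset.Icc (c + 1) (d - 1)).card).toReal :=
    fun x y => by
      rw [Real.norm_eq_abs, abs_of_nonneg (hMR0 x y), hMR]
      exact ENNReal.toReal_mono hCw (hMKle x y)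
  have hMR₁b : ∀ x y, ‖MR₁ x y‖ ≤ ((∫⁻ z, w z) ^ (Finset.Icc (c + 1) (d - 1)).card).toReal :=
    fun x y => by
      rw [Real.norm_eq_abs, abs_of_nonneg (hMR₁0 x y), hMR₁]
      exact ENNReal.toReal_mono hCw (hMK₁le x y)
  have hMRsm : StronglyMeasurable (uncurry MR) := by
    have h : uncurry MR = fun p => (uncurry MK p).toReal := funext fun p => hMR p.1 p.2
    rw [h]
    exact (measurable_windowKernel hkm hwm hFm hMK).ennreal_toReal.stronglyMeasurable
  have hMR₁sm : StronglyMeasurable (uncurry MR₁) := by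
    have h : uncurry MR₁ = fun p => (uncurry MK₁ p).toReal := funext fun p => hMR₁ p.1 p.2
    rw [h]
    exact (measurable_windowKernel hkm hwm measurable_const hMK₁).ennreal_toReal.stronglyMeasurable
  have hMR₁pos : ∀ x y, 0 < MR₁ x y := fun x y => by
    rw [hMR₁]
    exact ENNReal.toReal_pos
      (windowKernel_pos hkm hwm measurable_const (fun _ => zero_lt_one) hk0 hw0 hMK₁ x y).ne'
      (hMK₁ne x y)
  -- the `L²` window operators and the limit value
  obtain ⟨M, hM⟩ := exists_kernelOp (μ := ρ) hMRsm hMRb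
  obtain ⟨M₁, hM₁⟩ := exists_kernelOp (μ := ρ) hMR₁sm hMR₁b
  have hM₁pos : 0 < ⟪φ, M₁ φ⟫ := inner_kernelOp_self_pos hMR₁sm hMR₁b hMR₁pos hρ0 hM₁ hφae
  refine ⟨⟪φ, M φ⟫ / ⟪φ, M₁ φ⟫, fun δ hδ ε hε => ?_⟩
  obtain ⟨N₀, hN₀⟩ := exists_forall_abs_ratio_sub_lt (M := M) hlam hθ0 hθ hpow hks hM₁pos hδ hε
  refine ⟨N₀, fun n hn η hu hv => ?_⟩
  have hratio := hN₀ n hn (η (c - n - 1)) (η (d + n + 1)) hu hv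
  -- numerator and denominator of the Gibbs kernel as matrix elements
  obtain ⟨hNum, hNum0⟩ := P.lmarginal_boltzmann_eq_ofReal_inner hw' hk' hK hkm hwm hKsm hK1 hKsymm
    hρ hAsa hA hcd hFm hFd η₀ hMK hMKR hMR0 hMRb hMRsm hM n η
  obtain ⟨hDen, hDen0⟩ := P.lmarginal_boltzmann_eq_ofReal_inner hw' hk' hK hkm hwm hKsm hK1 hKsymm
    hρ hAsa hA hcd (G := fun _ => (1 : ℝ≥0∞)) measurable_const (fun _ _ _ => rfl) η₀ hMK₁ hMK₁R
    hMR₁0 hMR₁b hMR₁sm hM₁ n η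
  have hZ := (P.lmarginal_boltzmann_lt_top hT hV0 hUi (Finset.Icc (c - n) (d + n)) η).ne
  have hZpos := P.lmarginal_boltzmann_pos hUm hVm T (Finset.Icc (c - n) (d + n)) η
  rw [P.lintegral_chainSpecification_eq_lmarginal_div hUm hVm T _ η hZ hFm, hNum]
  have hDen' : (∫⋯∫⁻_Finset.Icc (c - n) (d + n), (fun σ =>
        ENNReal.ofReal (Real.exp (-T⁻¹ *
          hamiltonianIn P.chainPotential chainSupp (Finset.Icc (c - n) (d + n)) σ)))
      ∂fun _ : ℤ => (volume : Measure (ℝ × ℝ))) η =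
      ENNReal.ofReal ⟪(A ^ n) ((memLp_kernel_section (μ := ρ) hKsm hK1 (η (c - n - 1))).toLp
          (K (η (c - n - 1)))),
        M₁ ((A ^ n) ((memLp_kernel_section (μ := ρ) hKsm hK1 (η (d + n + 1))).toLp
          (K (η (d + n + 1)))))⟫ := by
    rw [← hDen]
    simp only [one_mul]
  rw [hDen']
  rw [hDen'] at hZpos
  have hdpos := ENNReal.ofReal_pos.1 hZpos
  rw [← ENNReal.ofReal_div_of_pos hdpos, ENNReal.toReal_ofReal (div_nonneg hNum0 hdpos.le)]
  exact hratio

end OscillatorChain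

end Literature.MathematicalPhysics.KineticTheory.HeatConduction

end
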